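import Mathlib
import Summits.CriticalPhenomena.CardyFormulaZ2.Theses.CardyFlipRusso
import Summits.CriticalPhenomena.CardyFormulaZ2.Theorems.CardyFlipRussoSquareFromVoronoiHubDefs
import Literature.Probability.Percolation.VoronoiCrossing
import Literature.Probability.Percolation.SitePercolationMeasure
import Literature.Analysis.FunctionSpaces.PoissonPointProcess

/-!
# Stub `stub_smallCells` (K0), Part 4 — line `Sketch`, crux `SquareFromVoronoiHub`
# (stmt-CriticalPhenomena-6434): geometry of the centred square lattice `G_s`

Support file for the K0 stub of `Cruxes/SquareFromVoronoiHub/Lines/Sketch.lean`, over the objects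
`zGs`, `Gs`, `crudeCrossing` of `Theorems/CardyFlipRussoSquareFromVoronoiHubDefs.lean`:

* `half_le_dist_zGs` — distinct vertices of `G_s = ℤ² ∪ (ℤ² + (½,½))` are at distance `≥ 1/2`;
  `dist_div_scale` — microscopic positions `δ z / δ²` are `1/δ` times further apart;
* `window_subset`, `card_box_disjSum` — the window `{y | δ z(y) ∈ Ω}` of a bounded `Ω ⊆ B(0,ρ)`
  lies in a box of `2 (2K+1)²` sites, `K > ρ/δ + 1/2`;
* `crudeCrossing_determinedBy` — the crude crossing event of a conformal rectangle at mesh `δ`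
  is determined by the colours of the window sites (its open paths live in `Ω`).

References: B. Bollobás, O. Riordan, *Percolation* (2006), Ch. 8 §8.3; G. Grimmett,
*Percolation* (1999), §2.2.
-/

noncomputable section

open scoped Topology MeasureTheory ENNReal Pointwise
open Filter Set MeasureTheory

namespace Summit.CriticalPhenomena.CardyFormulaZ2.Cruxes.SquareFromVoronoiHub.VoronoiBlocks.SmallCells

open Literature.Analysis.FunctionSpaces (PointConfig IsPoissonPointProcess)
open Literature.Probability.RandomPlanarGeometry (ConformalRectangle)
open Literature.Probability.Percolation (SiteConfig sitePercolation siteConnIn half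
  DeterminedBy determinedBy_iff siteOpenGraph_adj)

/-! ### Geometry of the centred square lattice `G_s` -/

/-- Real part of a corner vertex position. [folklore] -/
@[simp] theorem zGs_inl_re (a : ℤ × ℤ) : (zGs (Sum.inl a)).re = a.1 := by simp [zGs]

/-- Imaginary part of a corner vertex position. [folklore] -/
@[simp] theorem zGs_inl_im (a : ℤ × ℤ) : (zGs (Sum.inl a)).im = a.2 := by simp [zGs]

/-- Real part of a face-centre vertex position. [folklore] -/
@[simp] theorem zGs_inr_re (f : ℤ × ℤ) : (zGs (Sum.inr f)).re = f.1 + 1 / 2 := by simp [zGs]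

/-- Imaginary part of a face-centre vertex position. [folklore] -/
@[simp] theorem zGs_inr_im (f : ℤ × ℤ) : (zGs (Sum.inr f)).im = f.2 + 1 / 2 := by simp [zGs]

/-- Distinct integers are at distance `≥ 1`. [folklore] -/
theorem one_le_abs_intCast_sub {m n : ℤ} (h : m ≠ n) : (1 : ℝ) ≤ |(m : ℝ) - n| := by
  have h1 : (1 : ℤ) ≤ |m - n| := Int.one_le_abs (sub_ne_zero.2 h)
  have h2 : ((1 : ℤ) : ℝ) ≤ ((|m - n| : ℤ) : ℝ) := Int.cast_le.2 h1
  simpa [Int.cast_abs, Int.cast_sub] using h2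

/-- An integer is at distance `≥ 1/2` from `1/2`. [folklore] -/
theorem half_le_abs_intCast_sub_half (m : ℤ) : (1 / 2 : ℝ) ≤ |(m : ℝ) - 1 / 2| := by
  rcases le_or_gt 1 m with h | h
  · have : (1 : ℝ) ≤ m := by exact_mod_cast h
    rw [abs_of_nonneg (by linarith)]
    linarith
  · have h0 : m ≤ 0 := by omega
    have : (m : ℝ) ≤ 0 := by exact_mod_cast h0
    rw [abs_of_nonpos (by linarith)]
    linarith

/-- **Separation of `G_s`**: distinct vertices of the centred square lattice are at distance
`≥ 1/2` (in fact `≥ 1/√2`). [folklore] -/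
theorem half_le_dist_zGs {i j : (ℤ × ℤ) ⊕ (ℤ × ℤ)} (h : i ≠ j) :
    (1 / 2 : ℝ) ≤ dist (zGs i) (zGs j) := by
  rw [dist_eq_norm]
  have hre := Complex.abs_re_le_norm (zGs i - zGs j)
  have him := Complex.abs_im_le_norm (zGs i - zGs j)
  rw [Complex.sub_re] at hre
  rw [Complex.sub_im] at him
  rcases i with ⟨a, b⟩ | ⟨a, b⟩ <;> rcases j with ⟨c, d⟩ | ⟨c, d⟩
  · simp only [zGs_inl_re, zGs_inl_im] at hre him
    have hne : a ≠ c ∨ b ≠ d := by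
      by_contra hcon
      push Not at hcon
      exact h (by rw [hcon.1, hcon.2])
    rcases hne with hne | hne
    · linarith [one_le_abs_intCast_sub hne]
    · linarith [one_le_abs_intCast_sub hne]
  · simp only [zGs_inl_re, zGs_inr_re] at hre
    have : (1 / 2 : ℝ) ≤ |(a : ℝ) - (c + 1 / 2)| := by
      have := half_le_abs_intCast_sub_half (a - c)
      push_cast at this
      rwa [← sub_sub]
    linarith
  · simp only [zGs_inr_re, zGs_inl_re] at hre
    have : (1 / 2 : ℝ) ≤ |((a : ℝ) + 1 / 2) - c| := by
      have := half_le_abs_intCast_sub_half (c - a)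
      push_cast at this
      rw [abs_sub_comm]
      convert this using 2
      ring
    linarith
  · simp only [zGs_inr_re, zGs_inr_im] at hre him
    have hne : a ≠ c ∨ b ≠ d := by
      by_contra hcon
      push Not at hcon
      exact h (by rw [hcon.1, hcon.2])
    rcases hne with hne | hne
    · have := one_le_abs_intCast_sub hne
      have e : (a : ℝ) + 1 / 2 - (c + 1 / 2) = a - c := by ring
      rw [e] at hre
      linarith
    · have := one_le_abs_intCast_sub hne
      have e : (b : ℝ) + 1 / 2 - (d + 1 / 2) = b - d := by ring
      rw [e] at him
      linarith

/-- Distances between microscopic site positions: `dist (δa/δ²) (δb/δ²) = dist a b / δ`. [folklore] -/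
theorem dist_div_scale {δ : ℝ} (hδ : 0 < δ) (a b : ℂ) :
    dist ((δ : ℂ) * a / ((δ ^ 2 : ℝ) : ℂ)) ((δ : ℂ) * b / ((δ ^ 2 : ℝ) : ℂ)) = dist a b / δ := by
  have hδ' : (δ : ℂ) ≠ 0 := Complex.ofReal_ne_zero.2 hδ.ne'
  have e : ∀ c : ℂ, (δ : ℂ) * c / ((δ ^ 2 : ℝ) : ℂ) = c / (δ : ℂ) := by
    intro c
    push_cast
    field_simp
  rw [e, e, dist_eq_norm, ← sub_div, norm_div, Complex.norm_real, Real.norm_eq_abs,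
    abs_of_pos hδ, dist_eq_norm]

/-! ### The window of sites inside `Ω` -/

/-- An integer of real absolute value `< K` lies in `[-K, K]`. [folklore] -/
theorem int_mem_Icc_of_abs_lt {a : ℤ} {K : ℕ} (h : |(a : ℝ)| < K) :
    a ∈ Finset.Icc (-(K : ℤ)) K := by
  have h' : ((|a| : ℤ) : ℝ) < ((K : ℤ) : ℝ) := by simpa [Int.cast_abs] using h
  have h'' : |a| < (K : ℤ) := Int.cast_lt.1 h'
  rw [abs_lt] at h''
  rw [Finset.mem_Icc]
  omega

/-- **The window is finite**: the sites `y` with `δ z(y) ∈ Ω ⊆ B(0, ρ)` have lattice coordinates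
in `[-K, K]` as soon as `ρ/δ + 1/2 < K`. [folklore] -/
theorem window_subset {ρ δ : ℝ} (hδ : 0 < δ) (K : ℕ) (hK : ρ / δ + 1 / 2 < K) {Ω : Set ℂ}
    (hΩ : Ω ⊆ Metric.ball 0 ρ) :
    {y : (ℤ × ℤ) ⊕ (ℤ × ℤ) | (δ : ℂ) * zGs y ∈ Ω} ⊆
      ↑((Finset.Icc (-(K : ℤ)) K ×ˢ Finset.Icc (-(K : ℤ)) K).disjSum
        (Finset.Icc (-(K : ℤ)) K ×ˢ Finset.Icc (-(K : ℤ)) K)) := by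
  intro y hy
  have hnorm : ‖zGs y‖ < ρ / δ := by
    have h1 := hΩ hy
    rw [Metric.mem_ball, dist_zero_right, norm_mul, Complex.norm_real, Real.norm_eq_abs,
      abs_of_pos hδ] at h1
    rwa [lt_div_iff₀ hδ, mul_comm]
  have hre : |(zGs y).re| < ρ / δ := (Complex.abs_re_le_norm _).trans_lt hnorm
  have him : |(zGs y).im| < ρ / δ := (Complex.abs_im_le_norm _).trans_lt hnorm
  rcases y with ⟨a, b⟩ | ⟨a, b⟩
  · simp only [zGs_inl_re, zGs_inl_im] at hre him
    rw [Finset.mem_coe, Finset.inl_mem_disjSum, Finset.mem_product]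
    exact ⟨int_mem_Icc_of_abs_lt (by linarith), int_mem_Icc_of_abs_lt (by linarith)⟩
  · simp only [zGs_inr_re, zGs_inr_im] at hre him
    rw [Finset.mem_coe, Finset.inr_mem_disjSum, Finset.mem_product]
    have ha : |(a : ℝ)| < K := by
      have := abs_add_le ((a : ℝ) + 1 / 2) (-(1 / 2))
      rw [show (a : ℝ) + 1 / 2 + -(1 / 2) = a by ring, abs_neg,
        abs_of_pos (by norm_num : (0 : ℝ) < 1 / 2)] at this
      linarith
    have hb : |(b : ℝ)| < K := by
      have := abs_add_le ((b : ℝ) + 1 / 2) (-(1 / 2))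
      rw [show (b : ℝ) + 1 / 2 + -(1 / 2) = b by ring, abs_neg,
        abs_of_pos (by norm_num : (0 : ℝ) < 1 / 2)] at this
      linarith
    exact ⟨int_mem_Icc_of_abs_lt ha, int_mem_Icc_of_abs_lt hb⟩

/-- The bounding box of the window has `2 (2K+1)²` sites. [folklore] -/
theorem card_box_disjSum (K : ℕ) :
    (((Finset.Icc (-(K : ℤ)) K ×ˢ Finset.Icc (-(K : ℤ)) K).disjSum
        (Finset.Icc (-(K : ℤ)) K ×ˢ Finset.Icc (-(K : ℤ)) K)).card : ℝ) = 2 * (2 * K + 1) ^ 2 := by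
  have h : (Finset.Icc (-(K : ℤ)) K).card = 2 * K + 1 := by
    rw [Int.card_Icc]; omega
  rw [Finset.card_disjSum, Finset.card_product, h]
  push_cast
  ring

/-! ### The crude crossing event is determined by the window -/

/-- **Determinedness.** The crude crossing event of `R` at mesh `δ` depends only on the colours of
the sites `y` with `δ z(y) ∈ Ω` (the open path is required to stay in `Ω`). [folklore] -/
theorem crudeCrossing_determinedBy (R : ConformalRectangle) (δ : ℝ)
    {F : Finset ((ℤ × ℤ) ⊕ (ℤ × ℤ))}
    (hF : (↑F : Set ((ℤ × ℤ) ⊕ (ℤ × ℤ))) = {y | (δ : ℂ) * zGs y ∈ R.carrier}) :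
    DeterminedBy (crudeCrossing R δ) ↑F := by
  rw [determinedBy_iff]
  suffices key : ∀ ω ω' : Set ((ℤ × ℤ) ⊕ (ℤ × ℤ)), ω ∩ ↑F = ω' ∩ ↑F →
      ω ∈ crudeCrossing R δ → ω' ∈ crudeCrossing R δ from
    fun ω ω' h => ⟨key ω ω' h, key ω' ω h.symm⟩
  intro ω ω' hωω' hω
  obtain ⟨u, v, hu, hv, huω, hvω, huW, hvW, hreach⟩ := hω
  have hmem : ∀ y, (δ : ℂ) * zGs y ∈ R.carrier → (y ∈ ω ↔ y ∈ ω') := by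
    intro y hy
    have hyF : y ∈ (↑F : Set ((ℤ × ℤ) ⊕ (ℤ × ℤ))) := by rw [hF]; exact hy
    constructor
    · intro h; exact ((Set.ext_iff.1 hωω' y).1 ⟨h, hyF⟩).1
    · intro h; exact ((Set.ext_iff.1 hωω' y).2 ⟨h, hyF⟩).1
  refine ⟨u, v, hu, hv, (hmem u huW).1 huω, (hmem v hvW).1 hvω, huW, hvW, ?_⟩
  refine hreach.mono ?_
  intro a b hab
  rw [SimpleGraph.induce_adj, siteOpenGraph_adj] at hab ⊢
  exact ⟨hab.1, (hmem _ a.2).1 hab.2.1, (hmem _ b.2).1 hab.2.2⟩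

/-! ### Registered sub-goal of the stub (Part 4) -/

/-- **Part 4 of stub `stub_smallCells`, registered sub-goal** (`--supports stmt-CriticalPhenomena-6434`):
determinedness of the crude crossing event by the window, `crudeCrossing_determinedBy`, as a
closed statement. [folklore] -/
theorem stub_smallCells_part4 : ∀ (R : ConformalRectangle) (δ : ℝ) {F : Finset ((ℤ × ℤ) ⊕ (ℤ × ℤ))},
    (↑F : Set ((ℤ × ℤ) ⊕ (ℤ × ℤ))) = {y | (δ : ℂ) * zGs y ∈ R.carrier} →
    DeterminedBy (crudeCrossing R δ) ↑F := by
  intro R δ F hF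
  exact crudeCrossing_determinedBy R δ hF

end Summit.CriticalPhenomena.CardyFormulaZ2.Cruxes.SquareFromVoronoiHub.VoronoiBlocks.SmallCells

end
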